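import Literature.AlgebraicGeometry.Resolution.RegularCentreRsopGenerated
import Literature.AlgebraicGeometry.Resolution.RegularSubschemeLocallyIrreducible
import Literature.AlgebraicGeometry.Resolution.StalkSpecializesLocalization
import Literature.AlgebraicGeometry.Resolution.PrimeDivisorIdeals
import Literature.AlgebraicGeometry.Resolution.GenericPointStalkData
import Literature.AlgebraicGeometry.Resolution.StrictNormalCrossingsFlatDescent
import HarnessLib

/-!
# Membership in a power of a regular irreducible centre is constant along the centre
# (ordinary = symbolic powers for primes generated by part of a regular system of parameters)

Topic: `Literature/AlgebraicGeometry/Resolution`. Theorem-only file (sorry-free, no definitions, no named facts).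

Let `X` be a locally Noetherian scheme, `C` an ideal sheaf whose zero-scheme `V(C)` is REGULAR and IRREDUCIBLE,
with regular local rings `𝒪_{X,x}` at the points of `V(C)` (Matsumura Thm. 14.2: then `C_x` is generated by part
of a regular system of parameters, tree `isRsopGeneratedAt_of_isRegular_subscheme`), and `𝔟` ANY ideal sheaf. For
`n : ℕ` the condition «`𝔟_x ⊆ C_x ^ n`» does not depend on the point `x ∈ V(C)`: it holds at one point iff it
holds at the generic point `η` of `V(C)` (`𝔟_η ⊆ 𝔪_η ^ n`, i.e. `ord_η 𝔟 ≥ n`) iff it holds at every point, iff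
`𝔟 ≤ C ^ n`. Reason: `𝒪_{X,η} = (𝒪_{X,x})_{C_x}` (Stacks 01J7, tree `isLocalizationAtPrime_stalkSpecializes`) and
the powers of a prime generated by part of a regular system of parameters are primary, `C_x^{(n)} = C_x ^ n`
(Matsumura Thm. 16.2 (ii), tree `mem_pow_span_image_rsop_of_mul_mem`) — the argument of
Bierstone–Grigoriev–Milman–Włodarczyk 2011, Lemma 3.2.1 (1) («`C ⊂ supp(𝓘, μ)` … then `𝓘 ⊂ 𝓘_C^μ`»; tree
`stalkIdeal_le_pow_of_forall_le_idealOrder`) read at the generic point only.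

* `stalkIdeal_le_stalkIdeal_pow_of_specializes` — `𝔟_x ⊆ C_x ^ n` and `η ⤳ x` give `𝔟_η ⊆ C_η ^ n` (any `C`);
* `stalkIdeal_le_pow_of_isRsopGeneratedAt_of_generization` — conversely, for `C` rsop-generated at `x` and `η ⤳ x`
  the point of the prime `C_x` (`𝔭_η = C_x`), `𝔟_η ⊆ 𝔪_η ^ n` gives `𝔟_x ⊆ C_x ^ n`;
* `le_pow_or_forall_not_stalkIdeal_le_pow` — **MAIN (the weight dichotomy)**: for `V(C)` regular irreducible,
  EITHER `𝔟 ≤ C ^ n` OR `𝔟_z ⊄ C_z ^ n` at EVERY point `z ∈ V(C)`.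

Use (res-hironaka, chain W5.2, T5-E «W₂B-maxweight»): choosing the weight of a blowing up along a connected
component `Z` of a Cossart–Jannsen–Saito centre as `ν = 2` if `𝔟 ≤ 𝓘(Z)²` and `ν = 1` otherwise makes the
MAX-WEIGHT clause «`𝔟_z ⊄ 𝓘(Z)_z²` at every `z ∈ Z`» of a weight-one step hold by construction.

## References
* H. Matsumura, *Commutative Ring Theory* (1986), Thm. 14.2, Thm. 16.2 (ii). [Matsumura1987]
* E. Bierstone, D. Grigoriev, P. Milman, J. Włodarczyk, *Effective Hironaka resolution and its complexity*,
  Asian J. Math. 15 (2011), arXiv:1206.3090, §3.2 Lemma 3.2.1 (1). [BierstoneGrigorievMilmanWlodarczyk2011]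
* The Stacks Project, Tag 01J7. [StacksProject]
-/

noncomputable section

open CategoryTheory AlgebraicGeometry TopologicalSpace IsLocalRing

namespace Literature.AlgebraicGeometry.Resolution

universe u

open Scheme.IdealSheafData

variable {X : Scheme.{u}}

/-- **Generization preserves `𝔟_x ⊆ C_x ^ n`**: along `η ⤳ x`, `𝔟_η = 𝔟_x 𝒪_{X,η}` and `C_η = C_x 𝒪_{X,η}`
(Stacks 01J7), so `𝔟_x ⊆ C_x ^ n` implies `𝔟_η ⊆ C_η ^ n`. [cite: StacksProject, Tag 01J7] -/
theorem stalkIdeal_le_stalkIdeal_pow_of_specializes (𝔟 C : X.IdealSheafData) (n : ℕ) {η x : X} (h : η ⤳ x)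
    (hx : stalkIdeal 𝔟 x ≤ stalkIdeal C x ^ n) : stalkIdeal 𝔟 η ≤ stalkIdeal C η ^ n := by
  rw [← stalkIdeal_map_stalkSpecializes 𝔟 h, ← stalkIdeal_map_stalkSpecializes C h, ← Ideal.map_pow]
  exact Ideal.map_mono hx

/-- **BGMW Lemma 3.2.1 (1) read at the generic point**: if `C_x = (u_i : i ∈ S)` for a regular system of
parameters `u` of `𝒪_{X,x}` and `η ⤳ x` is the generization whose prime is `C_x` (`𝔭_η = C_x`; then
`𝒪_{X,η} = (𝒪_{X,x})_{C_x}` and `C_η = 𝔪_η`), then `𝔟_η ⊆ 𝔪_η ^ n` implies `𝔟_x ⊆ C_x ^ n` — because `C_x ^ n` is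
`C_x`-primary (Matsumura 16.2 (ii)). [cite: BierstoneGrigorievMilmanWlodarczyk2011, Lemma 3.2.1 (1)]
[cite: Matsumura1987, Thm. 16.2 (ii)] [cite: StacksProject, Tag 01J7] -/
theorem stalkIdeal_le_pow_of_isRsopGeneratedAt_of_generization {𝔟 C : X.IdealSheafData} {n : ℕ} {η x : X}
    (h : η ⤳ x) (hC : IsRsopGeneratedAt C x) (hCx : stalkIdeal C x = primeOfSpecializes h)
    (hη : stalkIdeal 𝔟 η ≤ maximalIdeal (X.presheaf.stalk η) ^ n) :
    stalkIdeal 𝔟 x ≤ stalkIdeal C x ^ n := by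
  classical
  obtain ⟨hreg, u, hu, S, hS⟩ := hC
  haveI := hreg
  -- `P := C_x = (u_i : i ∈ T)` for the finset `T = S`
  set T : Finset (Fin (maximalIdeal (X.presheaf.stalk x)).spanFinrank) := S.toFinite.toFinset with hTdef
  have hT : (T : Set _) = S := S.toFinite.coe_toFinset
  have hP' : stalkIdeal C x = Ideal.span (u '' (T : Set _)) := by rw [hT]; exact hS
  -- `𝒪_{X,η}` is the localization of `𝒪_{X,x}` at `P := 𝔭_η = C_x`
  letI alg := (X.presheaf.stalkSpecializes h).hom.toAlgebra
  haveI hloc := isLocalizationAtPrime_stalkSpecializes h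
  set P : Ideal (X.presheaf.stalk x) := primeOfSpecializes h with hPdef
  have hφ : algebraMap (X.presheaf.stalk x) (X.presheaf.stalk η) = (X.presheaf.stalkSpecializes h).hom := rfl
  have hst : ∀ I : X.IdealSheafData, stalkIdeal I η = (stalkIdeal I x).map (X.presheaf.stalkSpecializes h).hom :=
    fun I => (stalkIdeal_map_stalkSpecializes I h).symm
  have hCη : stalkIdeal C η = maximalIdeal (X.presheaf.stalk η) := by
    rw [hst C, ← hφ, hCx]
    exact IsLocalization.AtPrime.map_eq_maximalIdeal P (X.presheaf.stalk η)
  intro f hf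
  -- `φ f ∈ P ^ n 𝒪_{X,η}`
  have h1 : (X.presheaf.stalkSpecializes h).hom f ∈ (P ^ n).map (X.presheaf.stalkSpecializes h).hom := by
    rw [Ideal.map_pow, ← hCx, ← hst C, hCη]
    exact hη (by rw [hst 𝔟]; exact Ideal.mem_map_of_mem _ hf)
  -- pull back along the localization: `s f - i ↦ 0`, so `t (s f - i) = 0` with `s, t ∉ P`, `i ∈ P ^ n`
  obtain ⟨⟨i, s⟩, his⟩ := (IsLocalization.mem_map_algebraMap_iff P.primeCompl (X.presheaf.stalk η)).mp h1
  have h2 : algebraMap (X.presheaf.stalk x) (X.presheaf.stalk η) (f * s - i) = 0 := by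
    rw [map_sub, map_mul, hφ]
    exact sub_eq_zero.mpr his
  obtain ⟨t, ht⟩ := (IsLocalization.map_eq_zero_iff P.primeCompl (X.presheaf.stalk η) _).mp h2
  have h3 : ((t : X.presheaf.stalk x) * s) * f ∈ P ^ n := by
    have e : ((t : X.presheaf.stalk x) * s) * f = t * i := by
      have := ht
      linear_combination this
    rw [e]
    exact Ideal.mul_mem_left _ _ i.2
  have hts : ((t : X.presheaf.stalk x) * s) ∉ P := (t * s).2
  obtain ⟨a, ha⟩ : ∃ a : X.presheaf.stalk x, a = (t : X.presheaf.stalk x) * s := ⟨_, rfl⟩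
  rw [← ha] at h3 hts
  rw [← hCx, hP'] at h3 hts
  rw [hP']
  exact mem_pow_span_image_rsop_of_mul_mem rfl u hu T hts n h3

/-- **The weight dichotomy along a regular irreducible centre.** On a locally Noetherian scheme with regular
local rings at the points of `V(C)`, for `V(C)` a regular IRREDUCIBLE closed subscheme and any ideal sheaf `𝔟` and
`n : ℕ`: either `𝔟 ≤ C ^ n`, or `𝔟_z ⊄ C_z ^ n` at EVERY point `z` of `V(C)` (membership in `C ^ n` is decided at
the generic point of `V(C)`; Matsumura 16.2 (ii) with Stacks 01J7).
[cite: Matsumura1987, Thm. 14.2 and Thm. 16.2 (ii)] [cite: BierstoneGrigorievMilmanWlodarczyk2011, Lemma 3.2.1 (1)] -/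
theorem le_pow_or_forall_not_stalkIdeal_le_pow [IsLocallyNoetherian X] {C : X.IdealSheafData}
    (hC : Scheme.IsRegular C.subscheme) (hirr : IsIrreducible (C.support : Set X))
    (hreg : ∀ x ∈ C.support, IsRegularLocalRing (X.presheaf.stalk x)) (𝔟 : X.IdealSheafData) (n : ℕ) :
    𝔟 ≤ C ^ n ∨ ∀ z ∈ C.support, ¬ stalkIdeal 𝔟 z ≤ stalkIdeal C z ^ n := by
  classical
  by_cases hex : ∃ z ∈ C.support, stalkIdeal 𝔟 z ≤ stalkIdeal C z ^ n
  swap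
  · push Not at hex
    exact Or.inr hex
  refine Or.inl ?_
  obtain ⟨z₀, hz₀, hz₀le⟩ := hex
  -- the generic point `η` of `V(C) = cl{η}`
  set η : X := hirr.genericPoint with hηdef
  have hcl : closure ({η} : Set X) = (C.support : Set X) := by
    rw [hηdef, hirr.isGenericPoint_genericPoint_closure.def, C.support.isClosed.closure_eq]
  have hspec : ∀ x ∈ (C.support : Set X), η ⤳ x := fun x hx => by
    rw [specializes_iff_mem_closure, hcl]; exact hx
  -- `C = 𝓘(V(C)) = 𝓘(cl{η})`, so `C_x = 𝔭_η` at every `x ∈ V(C)`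
  have hCeq : C = vanishingIdeal ⟨closure {η}, isClosed_closure⟩ := by
    rw [eq_vanishingIdeal_support_of_isRegular C hC]
    congr 1
    exact Closeds.ext hcl.symm
  have hCx : ∀ {x : X} (hx : x ∈ (C.support : Set X)), stalkIdeal C x = primeOfSpecializes (hspec x hx) :=
    fun hx => by
      conv_lhs => rw [hCeq]
      exact stalkIdeal_vanishingIdeal_closure (hspec _ hx)
  -- at `η`: `𝔟_η ⊆ C_η ^ n = 𝔪_η ^ n` by generization from `z₀`
  have hη : stalkIdeal 𝔟 η ≤ maximalIdeal (X.presheaf.stalk η) ^ n := by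
    have h := stalkIdeal_le_stalkIdeal_pow_of_specializes 𝔟 C n (hspec z₀ hz₀) hz₀le
    have hCη : stalkIdeal C η = maximalIdeal (X.presheaf.stalk η) := by
      rw [hCeq]; exact stalkIdeal_vanishingIdeal_closure_self η
    rwa [hCη] at h
  -- at every point
  refine le_of_forall_stalkIdeal_le fun x => ?_
  rw [stalkIdeal_pow]
  by_cases hx : x ∈ C.support
  · haveI := hreg x hx
    exact stalkIdeal_le_pow_of_isRsopGeneratedAt_of_generization (hspec x hx)
      (isRsopGeneratedAt_of_isRegular_subscheme hC hx) (hCx hx) hη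
  · rw [stalkIdeal_eq_top_of_not_mem_support hx, Ideal.top_pow]
    exact le_top

/-- The same on a REGULAR locally Noetherian scheme. [cite: Matsumura1987, Thm. 16.2 (ii)]
[cite: BierstoneGrigorievMilmanWlodarczyk2011, Lemma 3.2.1 (1)] -/
theorem le_pow_or_forall_not_stalkIdeal_le_pow_of_isRegular [IsLocallyNoetherian X] (hX : Scheme.IsRegular X)
    {C : X.IdealSheafData} (hC : Scheme.IsRegular C.subscheme) (hirr : IsIrreducible (C.support : Set X))
    (𝔟 : X.IdealSheafData) (n : ℕ) :
    𝔟 ≤ C ^ n ∨ ∀ z ∈ C.support, ¬ stalkIdeal 𝔟 z ≤ stalkIdeal C z ^ n :=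
  le_pow_or_forall_not_stalkIdeal_le_pow hC hirr (fun x _ => hX x) 𝔟 n

end Literature.AlgebraicGeometry.Resolution

end
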